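import Summits.Ventures.PercRepro.ProfilePointedCircuitClassesStarSharpD0Z
import Summits.Ventures.PercRepro.ProfilePointedCircuitClassesStarSharpD0J

/-!
# PercRepro — CASE D0 OF `StarNineSharp`, PART Z1: THE WHOLE «NO ON LINE THROUGH `e`» REGIME AS ONE THEOREM
(p5, gen 55; `proofs/P5-GM1.md` §82 (e))

`inCount_thru_le_of_no_on_line_e`: on a coloop-free `N` (`#E = 9`, `ρ = 5`, series pair `{b, b′}`, `e ≠ f` outside
it) with `ρ(E₇) = 4`, no ON line through `e`, `e` and `f` simple on `X`, `f` cosimple, `ρ(X) = 4`, `ρ{e, f} = 2` and a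
`b`-generic `b` (`ρ{y, b, b′} = 3` on `X`), the `b′`-avoiding inequality holds.  Either no ON plane through `e, f`
exists (D0P), or one does — `on_plane_of_on_set` (D0J) produces the flat `H`, whose trace has at most three points
(`card_H_le_five`): at most two (D0S) or exactly three (D0R with the `ef`-plane bound of part Z).
This single theorem replaces the six instance theorems D0K, D0P, D0S ×3, D0T on the `b`-generic configurations
(the 167,342 configurations of §81 ADD 12), with no instance condition left to case-split on.
-/

open scoped Matroid

namespace PercRepro.Cogirth

open Finset ThmH Skew Shadow Profile

open Classical

variable {α : Type} [DecidableEq α] {N : Matroid α} [N.Finite]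

section StarSharpD0Z1

variable {b b' : α}

/-- **THE «NO ON LINE THROUGH `e`» REGIME OF CASE D0** (`b`-generic): the `b′`-avoiding inequality holds. -/
theorem inCount_thru_le_of_no_on_line_e (hn : (gr N).card = 9) (hR : rk N (gr N) = 5)
    (hcf : ∀ x ∈ gr N, rk N ((gr N).erase x) = 5) (h : SeriesPair N b b')
    {e f : α} (he : e ∈ gr N) (hf : f ∈ gr N) (hef : e ≠ f) (heb : e ≠ b) (heb' : e ≠ b') (hfb : f ≠ b) (hfb' : f ≠ b')
    (hE7 : rk N (((gr N).erase b).erase b') = 4)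
    (hnle : ∀ S : Finset α, S ⊆ ((gr N).erase b).erase b' → e ∈ S → rk N (insert b (insert b' S)) ≤ 3 → rk N S ≤ 1)
    (he1 : ∀ y ∈ ((((gr N).erase b).erase b').erase f).erase e, rk N {e, y} = 2)
    (hf1 : ∀ y ∈ ((((gr N).erase b).erase b').erase f).erase e, rk N {f, y} = 2)
    (hfc : ∀ y ∈ ((((gr N).erase b).erase b').erase f).erase e, rk N (((((gr N).erase b).erase b').erase f).erase y) = 4)
    (hX : rk N (((((gr N).erase b).erase b').erase f).erase e) = 4) (hef2 : rk N {e, f} = 2)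
    (hbg : ∀ y ∈ ((((gr N).erase b).erase b').erase f).erase e, rk N {y, b, b'} = 3) :
    inCount N 4 e + thruCount N 4 {b', f} + thruCount N 4 {b', e, f} ≤
      inCount N 4 f + thruCount N 4 {e, f} + thruCount N 4 {b', e} := by
  by_cases hefp : ∀ Y : Finset α, Y ⊆ ((gr N).erase b).erase b' → e ∈ Y → f ∈ Y → rk N Y = 3 →
      rk N (insert b (insert b' Y)) = 5
  · exact inCount_thru_le_of_no_on_line_e_no_ef hn hR hcf h he hf hef heb heb' hfb hfb' hE7 hnle he1 hfc hX hefp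
  · push Not at hefp
    obtain ⟨Y₀, hY₀, heY₀, hfY₀, hY₀3, hY₀on'⟩ := hefp
    have hY₀on : rk N (insert b (insert b' Y₀)) = 4 := by
      have := rk_insert_bb'_bounds h hY₀
      rw [hY₀3] at this
      omega
    obtain ⟨H, hH, heH, hfH, hH3, hHon, hHfl⟩ := on_plane_of_on_set h hE7 hY₀ heY₀ hfY₀ hY₀3 hY₀on
    have hT : ((H.erase e).erase f).card ≤ 3 := by
      have h5 := card_H_le_five h hn hcf hE7 hH hH3 hHon
      rw [card_erase_of_mem (mem_erase.2 ⟨hef.symm, hfH⟩), card_erase_of_mem heH]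
      omega
    by_cases hT3 : ((H.erase e).erase f).card = 3
    · exact inCount_thru_le_of_no_on_line_e_of_H_bound hn hR hcf h he hf hef heb heb' hfb hfb' hE7 hnle he1 hfc hX
        (hHcls_of_trace_three hn hR h he hf hef heb heb' hfb hfb' hE7 hnle he1 hf1 hX hef2 hbg hH heH hfH hH3 hHon
          hHfl hT3)
    · exact inCount_thru_le_of_no_on_line_e_of_trace_le_two hn hR hcf h he hf hef heb heb' hfb hfb' hE7 hnle he1 hf1
        hfc hX hef2 hH heH hfH hH3 hHon hHfl (by omega)

end StarSharpD0Z1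

end PercRepro.Cogirth
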